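import Literature.Computability.Cryptography.PRPSwitchingLemma
import Literature.Computability.Complexity.OracleQueryMap
import HarnessLib

/-!
# Random functions seen through a query map: the XOR-mask lemma behind Simon-type oracles

Topic `Literature/Computability/Cryptography`; a companion of `PRPSwitchingLemma.lean`, on the
same lazy-sampling infrastructure (`PTable`, `prF`, `prF_fresh`). It serves the Servedio–Gortler /
Simon variant of the `P/poly`-oracle separation of Aaronson–Chen 2017, Thm. 7.6
(`Literature/Barriers/QuantumAdvantage/PPolyOraclesThm76Sig.lean`), whose non-permutation levels
are `PRP_k ∘ rep_s` for a hidden XOR mask `s` with head bit `1` (`repStr s x` = the element of the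
orbit `{x, x ⊕ s}` with head bit `0` — S–G 2004, §6: "`f` is invariant under XOR mask with `s` if
`f(x) = f(x ⊕ s)` for all `x`").

**The lemma** (folklore; the classical half of Simon's analysis, cf. D. Simon, *On the power of
quantum computation*, SIAM J. Comput. 26 (1997), Thm. 3.4, and Servedio–Gortler 2004, Thm. 6.1 (ii):
a classical algorithm learns nothing about `s` unless two of its queries collide under the mask).
For a deterministic transcript algorithm `M` with fuel `k`, a uniformly random function table
`h : {0,1}^a → {0,1}^a` and ANY query map `κ : {0,1}^a → {0,1}^a`, the games "oracle `h`" and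
"oracle `h ∘ κ`" are identical until the algorithm asks two distinct well-formed queries `u ≠ w`
with `κ u = κ w` (`abs_prF_sub_prF_kappa_le`, by induction on the fuel over pairs of partial
tables transported along `κ`); for the masks `κ = rep_s` a collision `rep_s u = rep_s w`, `u ≠ w`
forces `s = u ⊕ w`, so over ALL masks `s` at most `k²` are bad for a given run
(`sum_prF_maskBad_le`); hence, averaging over any set `S` of masks,
`(1/|S|) ∑_{s ∈ S} |Pr_h[M^h ∈ E] − Pr_h[M^{h ∘ rep_s} ∈ E]| ≤ k²/|S|` (`avg_abs_prF_sub_prF_rep_le`).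

**Also proved**: through the tree's query rewriting `OracleAlg.mapQuery` (`OracleQueryMap.lean`;
here with a rewriting `qOnly φ` reading the query alone, `run_mapQuery_qOnly`: the run against `O`
with queries translated by `φ` is the run against `O ∘ φ`), the switching lemma of
`PRPSwitchingLemma.lean` applies under the mask as well (`abs_prF_sub_prP_rep_le_root`).

## Main statements

* `xorStr`, `repStr`, `repV` and their algebra (`repStr_xorStr`, `repStr_eq_or`,
  `eq_or_eq_xor_of_repStr_eq`).
* `abs_prF_sub_prF_kappa_le`, `abs_prF_sub_prF_kappa_le_root` — identical-until-collision.
* `sum_prF_maskBad_le` — over all masks, the collision probabilities sum to at most `k²`.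
* `avg_abs_prF_sub_prF_rep_le` — the XOR-mask lemma.
* `qOnly`, `run_mapQuery_qOnly`, `oracleOfTable_comp_repV`, `abs_prF_sub_prP_rep_le_root`.

## References

* [ServedioGortler2004] R. Servedio, S. Gortler, *Equivalences and separations between quantum and
  classical learnability*, SIAM J. Comput. 33 (2004), §6 (Simon's algorithm; XOR masks), Thm. 6.1
  (held, read via `lit read doi:10.1137/s0097539704412910`, p. 14).
* [AaronsonChen2017] S. Aaronson, L. Chen, CCC 2017, §1 (pp. 9, 11: the construction "independently
  proposed by Zhandry and by Servedio and Gortler") and Thm. 7.6.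
* [Goldreich2001] O. Goldreich, *Foundations of Cryptography I*, §3.6–3.7 (the lazy-sampling view of a
  random function), through `PRPSwitchingLemma.lean`.
-/

namespace Literature.Computability.Cryptography

open Filter Asymptotics _root_.Computability Complexity Finset

/-! ### XOR masks and orbit representatives -/

/-- Bitwise XOR of `x` with the mask `s` when the lengths agree (and `x` unchanged otherwise, so
that the length of `x` is always preserved). [cite: ServedioGortler2004, §6] -/
def xorStr (x s : List Bool) : List Bool :=
  if x.length = s.length then List.zipWith xor x s else x

/-- `xorStr` preserves the length. [folklore] -/
@[simp] theorem length_xorStr (x s : List Bool) : (xorStr x s).length = x.length := by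
  unfold xorStr
  split_ifs with h
  · rw [List.length_zipWith, h, min_self]
  · rfl

/-- Double XOR with the same mask is the identity (`zipWith` form). [folklore] -/
theorem zipWith_xor_zipWith_xor : ∀ (x s : List Bool), x.length = s.length →
    List.zipWith xor (List.zipWith xor x s) s = x
  | [], [], _ => rfl
  | b :: x, c :: s, h => by
    simp only [List.zipWith_cons_cons, Bool.xor_assoc, Bool.xor_self, Bool.xor_false,
      List.cons.injEq, true_and]
    exact zipWith_xor_zipWith_xor x s (by simpa using h)
  | [], _ :: _, h => by simp at h
  | _ :: _, [], h => by simp at h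

/-- **`x ↦ x ⊕ s` is an involution** on the strings of the length of `s`. [folklore] -/
theorem xorStr_xorStr {x s : List Bool} (h : x.length = s.length) : xorStr (xorStr x s) s = x := by
  have h1 : xorStr x s = List.zipWith xor x s := if_pos h
  have h2 : (List.zipWith xor x s).length = s.length := by rw [List.length_zipWith, h, min_self]
  rw [h1, xorStr, if_pos h2, zipWith_xor_zipWith_xor x s h]

/-- **The orbit representative** of `x` under a mask `s` WITH HEAD BIT `1`: the element of the
orbit `{x, x ⊕ s}` whose head bit is `0`, i.e. `rep_s x = x ⊕ s` if `x` starts with `1` and `x`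
otherwise (S–G's XOR-mask structure: `g ∘ rep_s` is invariant under XOR mask with `s`; choosing the
representative by one bit keeps the map trivially computable). [cite: ServedioGortler2004, §6] -/
def repStr (s : List Bool) : List Bool → List Bool
  | true :: x => xorStr (true :: x) s
  | x => x

/-- `rep_s x` is `x` or `x ⊕ s`. [folklore] -/
theorem repStr_eq_or (s x : List Bool) : repStr s x = x ∨ repStr s x = xorStr x s := by
  rcases x with _ | ⟨_ | _, x⟩
  · exact Or.inl rfl
  · exact Or.inl rfl
  · exact Or.inr rfl

/-- `repStr` preserves the length. [folklore] -/
@[simp] theorem length_repStr (s x : List Bool) : (repStr s x).length = x.length := by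
  rcases repStr_eq_or s x with h | h <;> rw [h]
  rw [length_xorStr]

/-- On strings with head bit `0` the representative is the string itself. [folklore] -/
theorem repStr_cons_false (s x : List Bool) : repStr s (false :: x) = false :: x :=
  rfl

/-- On strings with head bit `1` the representative is the masked string. [folklore] -/
theorem repStr_cons_true (s x : List Bool) : repStr s (true :: x) = xorStr (true :: x) s :=
  rfl

/-- **Mask invariance**: `rep_s (x ⊕ s) = rep_s x` for a mask with head bit `1` (on the strings of
the length of `s`). [cite: ServedioGortler2004, §6] -/
theorem repStr_xorStr {s x : List Bool} (hs : s.head? = some true) (h : x.length = s.length) :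
    repStr s (xorStr x s) = repStr s x := by
  obtain ⟨t, rfl⟩ : ∃ t, s = true :: t := by
    rcases s with _ | ⟨b, t⟩
    · simp at hs
    · simp only [List.head?_cons, Option.some.injEq] at hs
      exact ⟨t, by rw [hs]⟩
  obtain ⟨b, x, rfl⟩ : ∃ b x', x = b :: x' := by
    rcases x with _ | ⟨b, x'⟩
    · simp at h
    · exact ⟨b, x', rfl⟩
  cases b
  · -- `x` starts with `0`: `rep x = x`, and `x ⊕ s` starts with `1`, `rep (x ⊕ s) = (x ⊕ s) ⊕ s = x`
    have hx : xorStr (false :: x) (true :: t) = true :: List.zipWith xor x t := by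
      rw [xorStr, if_pos h, List.zipWith_cons_cons]; rfl
    rw [hx, repStr_cons_true, repStr_cons_false, ← hx, xorStr_xorStr h]
  · -- `x` starts with `1`: `rep x = x ⊕ s`, which starts with `0` and is its own representative
    have hx : xorStr (true :: x) (true :: t) = false :: List.zipWith xor x t := by
      rw [xorStr, if_pos h, List.zipWith_cons_cons]; rfl
    rw [repStr_cons_true, hx, repStr_cons_false]

/-- **Collisions of `rep_s` are mask pairs**: `rep_s u = rep_s w` forces `u = w` or `u = w ⊕ s`.
[cite: ServedioGortler2004, §6 ("`f(x) = f(y) ⟺ y = x ⊕ s`")] -/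
theorem eq_or_eq_xor_of_repStr_eq {s u w : List Bool} (hu : u.length = s.length)
    (hw : w.length = s.length) (h : repStr s u = repStr s w) : u = w ∨ u = xorStr w s := by
  rcases repStr_eq_or s u with h1 | h1 <;> rcases repStr_eq_or s w with h2 | h2 <;>
    rw [h1, h2] at h
  · exact Or.inl h
  · exact Or.inr h
  · right
    rw [← xorStr_xorStr hu, h]
  · left
    rw [← xorStr_xorStr hu, h, xorStr_xorStr hw]

/-- The representative map on `{0,1}^a` (vectors), for a mask `s ∈ {0,1}^a`. [cite: ServedioGortler2004, §6] -/
def repV {a : ℕ} (s v : List.Vector Bool a) : List.Vector Bool a :=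
  ⟨repStr s.toList v.toList, by rw [length_repStr, v.toList_length]⟩

/-- The XOR of two vectors of `{0,1}^a`. [folklore] -/
def xorV {a : ℕ} (v s : List.Vector Bool a) : List.Vector Bool a :=
  ⟨xorStr v.toList s.toList, by rw [length_xorStr, v.toList_length]⟩

/-- `repV` computes `repStr` (definitional). [folklore] -/
@[simp] theorem toList_repV {a : ℕ} (s v : List.Vector Bool a) :
    (repV s v).toList = repStr s.toList v.toList :=
  rfl

/-- `xorV` computes `xorStr` (definitional). [folklore] -/
@[simp] theorem toList_xorV {a : ℕ} (v s : List.Vector Bool a) :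
    (xorV v s).toList = xorStr v.toList s.toList :=
  rfl

/-- **Collisions of `repV` determine the mask**: `repV s u = repV s w` with `u ≠ w` forces
`s = u ⊕ w`. [cite: ServedioGortler2004, §6] -/
theorem eq_xorV_of_repV_eq {a : ℕ} {s u w : List.Vector Bool a} (h : repV s u = repV s w)
    (hne : u ≠ w) : s = xorV w u := by
  have h' : repStr s.toList u.toList = repStr s.toList w.toList := by
    simpa using congrArg List.Vector.toList h
  rcases eq_or_eq_xor_of_repStr_eq (by simp) (by simp) h' with h1 | h1
  · exact absurd (List.Vector.eq _ _ h1) hne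
  · -- `u = w ⊕ s`, hence `w ⊕ u = s`
    apply List.Vector.eq
    simp only [toList_xorV]
    have hws : w.toList.length = s.toList.length := by simp
    have hus : u.toList.length = s.toList.length := by simp
    -- pointwise: `w ⊕ (w ⊕ s) = s`
    have key : ∀ (x t : List Bool), x.length = t.length →
        List.zipWith xor x (List.zipWith xor x t) = t := by
      intro x
      induction x with
      | nil => intro t ht; cases t with | nil => rfl | cons _ _ => simp at ht
      | cons b x ih =>
        intro t ht
        cases t with
        | nil => simp at ht
        | cons c t =>
          simp only [List.zipWith_cons_cons, ← Bool.xor_assoc, Bool.xor_self, Bool.false_xor,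
            List.cons.injEq, true_and]
          exact ih t (by simpa using ht)
    have h2 : xorStr w.toList s.toList = List.zipWith xor w.toList s.toList := if_pos hws
    have h3 : (List.zipWith xor w.toList s.toList).length = w.toList.length := by
      rw [List.length_zipWith, hws, min_self]
    rw [h1, h2, xorStr, if_pos h3.symm, key _ _ hws]

/-! ### Transcript algorithms with translated queries -/

section MapQuery

variable {β : Type}

/-- A query rewriting that only looks at the query: the argument of `OracleAlg.mapQuery`
(`OracleQueryMap.lean`) is `⟨x, ⟨listBool as, q⟩⟩`; `qOnly φ` applies `φ` to its last field `q`.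
[folklore] -/
def qOnly (φ : List Bool → List Bool) (arg : List Bool) : List Bool :=
  φ (boolUnpair (boolUnpair arg).2).2

/-- `qOnly φ` rewrites the query `q` to `φ q`. [folklore] -/
@[simp] theorem qOnly_apply (φ : List Bool → List Bool) (x e q : List Bool) :
    qOnly φ (boolPair x (boolPair e q)) = φ q := by
  simp [qOnly]

/-- **Translating the queries by `φ` is running against `O ∘ φ`** (the tree's `run_mapQuery` with
the trivially satisfied agreement condition). [cite: AroraBarak2009, §3.4] -/
theorem run_mapQuery_qOnly (M : OracleAlg β) (φ : List Bool → List Bool) (O : Oracle) (k : ℕ)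
    (x : List Bool) : (M.mapQuery (qOnly φ)).run O k x = M.run (O ∘ φ) k x :=
  OracleAlg.run_mapQuery M (qOnly φ) O (O ∘ φ) x (fun _ q _ _ => by simp) k

end MapQuery

/-- **The masked table oracle is the table oracle behind the translation `repStr`**:
`oracleOfTable (h ∘ repV s) = oracleOfTable h ∘ repStr s` (the translation preserves lengths, so
ill-formed queries stay ill-formed). [folklore] -/
theorem oracleOfTable_comp_repV {a : ℕ} (h : List.Vector Bool a → List.Vector Bool a)
    (s : List.Vector Bool a) :
    oracleOfTable (h ∘ repV s) = oracleOfTable h ∘ repStr s.toList := by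
  funext q
  simp only [Function.comp]
  by_cases hq : q.length = a
  · have hq' : (repStr s.toList q).length = a := by rw [length_repStr, hq]
    rw [oracleOfTable_apply_of_length_eq _ hq, oracleOfTable_apply_of_length_eq _ hq']
    rfl
  · have hq' : (repStr s.toList q).length ≠ a := by rw [length_repStr]; exact hq
    rw [oracleOfTable_apply_of_length_ne _ hq, oracleOfTable_apply_of_length_ne _ hq']

/-! ### Identical until a collision under the query map -/

section Kappa

variable {β : Type} {a : ℕ}

/-- **The collision event** of the run of `M` (oracle `h`, from the answers `ans` with fuel `k`)
under the query map `κ`: two distinct well-formed points with the same `κ`-image, one asked during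
the run and the other asked during the run or already in the table `τ`. [folklore] -/
def KBad (M : OracleAlg β) (z : List Bool) (κ : List.Vector Bool a → List.Vector Bool a) (k : ℕ)
    (ans : List (List Bool)) (τ : PTable a) (h : List.Vector Bool a → List.Vector Bool a) : Prop :=
  ∃ u w : List.Vector Bool a, u.toList ∈ M.queriesAux (oracleOfTable h) z k ans ∧
    (w.toList ∈ M.queriesAux (oracleOfTable h) z k ans ∨ τ w ≠ none) ∧ w ≠ u ∧ κ w = κ u

/-- **The coupling invariant** between the partial table `τ` of the game "oracle `h`" and the
partial table `ρ` of the game "oracle `h ∘ κ`": `ρ` is `τ` transported along `κ`, and `κ` is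
injective on the domain of `τ`. [folklore] -/
def KInv (κ : List.Vector Bool a → List.Vector Bool a) (τ ρ : PTable a) : Prop :=
  (∀ w y, τ w = some y → ρ (κ w) = some y) ∧
    (∀ x y, ρ x = some y → ∃ w, τ w = some y ∧ κ w = x) ∧
    ∀ w w' y y', τ w = some y → τ w' = some y' → κ w = κ w' → w = w'

/-- The empty tables are coupled. [folklore] -/
theorem kInv_bot (κ : List.Vector Bool a → List.Vector Bool a) :
    KInv κ (fun _ => none) (fun _ => none) :=
  ⟨fun _ _ h => by simp at h, fun _ _ h => by simp at h, fun _ _ _ _ h => by simp at h⟩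

/-- Extending coupled tables at a point fresh in both games keeps them coupled. [folklore] -/
theorem KInv.update {κ : List.Vector Bool a → List.Vector Bool a} {τ ρ : PTable a}
    (hI : KInv κ τ ρ) {v : List.Vector Bool a} (hτv : τ v = none) (hρv : ρ (κ v) = none)
    (y : List.Vector Bool a) :
    KInv κ (Function.update τ v (some y)) (Function.update ρ (κ v) (some y)) := by
  obtain ⟨h1, h2, h3⟩ := hI
  refine ⟨fun w y' hw => ?_, fun x y' hx => ?_, fun w w' y₁ y₂ hw hw' hk => ?_⟩
  · by_cases hwv : w = v
    · subst hwv
      rw [Function.update_self] at hw ⊢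
      exact hw
    · rw [Function.update_of_ne hwv] at hw
      have hk : κ w ≠ κ v := fun hk => by
        rw [← hk, h1 w y' hw] at hρv
        exact Option.some_ne_none _ hρv
      rw [Function.update_of_ne hk]
      exact h1 w y' hw
  · by_cases hxv : x = κ v
    · subst hxv
      rw [Function.update_self] at hx
      cases hx
      exact ⟨v, by rw [Function.update_self], rfl⟩
    · rw [Function.update_of_ne hxv] at hx
      obtain ⟨w, hw, hwx⟩ := h2 x y' hx
      have hwv : w ≠ v := fun hwv => by rw [hwv, hτv] at hw; exact Option.some_ne_none _ hw.symm
      exact ⟨w, by rw [Function.update_of_ne hwv]; exact hw, hwx⟩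
  · -- injectivity on the new domain: `κ v` is not a `κ`-image of the old domain
    have fresh : ∀ w y₀, τ w = some y₀ → κ w ≠ κ v := fun w y₀ hw hk => by
      rw [← hk, h1 w y₀ hw] at hρv
      exact Option.some_ne_none _ hρv
    by_cases hwv : w = v
    · by_cases hw'v : w' = v
      · rw [hwv, hw'v]
      · rw [Function.update_of_ne hw'v] at hw'
        exact absurd (hwv ▸ hk).symm (fresh w' y₂ hw')
    · rw [Function.update_of_ne hwv] at hw
      by_cases hw'v : w' = v
      · subst hw'v
        exact absurd hk (fresh w y₁ hw)
      · rw [Function.update_of_ne hw'v] at hw'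
        exact h3 w w' y₁ y₂ hw hw' hk

/-- For two probabilities, `|p − p'| ≤ 1`. [folklore] -/
theorem abs_sub_le_one_of_mem {p p' : ℝ} (hp0 : 0 ≤ p) (hp1 : p ≤ 1) (hq0 : 0 ≤ p') (hq1 : p' ≤ 1) :
    |p - p'| ≤ 1 := by
  rw [abs_le]; constructor <;> linarith

/-- **Identical until a `κ`-collision.** For a deterministic transcript algorithm `M` on input `z`,
continued from the answers `ans` with fuel `k`, and coupled partial tables `(τ, ρ)`: the probability
(uniform function extending `τ`) that the run against `h` ends in `E` and the probability (uniform
function extending `ρ`) that the run against `h ∘ κ` ends in `E` differ by at most the probability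
of a `κ`-collision in the first game. Proof by induction on the fuel: a halting or ill-formed step
changes nothing; a query repeated in the first game is, by the coupling, answered identically in the
second; a query fresh in both games is lazily sampled in both (`prF_fresh`) and the coupling
extends; a query fresh in the first game whose `κ`-image was already asked is a collision.
[cite: ServedioGortler2004, Thm. 6.1 (ii) (the classical half of Simon's analysis)] -/
theorem abs_prF_sub_prF_kappa_le (M : OracleAlg β) (z : List Bool) (E : Set (Option β))
    (κ : List.Vector Bool a → List.Vector Bool a) :
    ∀ (k : ℕ) (ans : List (List Bool)) (τ ρ : PTable a), KInv κ τ ρ →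
      |prF τ (fun h => M.runAux (oracleOfTable h) z k ans ∈ E) -
          prF ρ (fun h => M.runAux (oracleOfTable (h ∘ κ)) z k ans ∈ E)| ≤
        prF τ (KBad M z κ k ans τ) := by
  classical
  intro k
  induction k with
  | zero =>
    intro ans τ ρ _
    simp only [OracleAlg.runAux_zero]
    rw [prF_const, prF_const, sub_self, abs_zero]
    exact prF_nonneg _ _
  | succ k ih =>
    intro ans τ ρ hI
    cases hs : M.step z ans with
    | inr b =>
      -- halting step
      have hev : ∀ (O : (List.Vector Bool a → List.Vector Bool a) → Oracle)
          (f : List.Vector Bool a → List.Vector Bool a),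
          (M.runAux (O f) z (k + 1) ans ∈ E ↔ some b ∈ E) := fun O f => by
        simp only [OracleAlg.runAux_succ, hs]
      rw [prF_congr (fun f _ => hev (fun f => oracleOfTable f) f),
        prF_congr (fun f _ => hev (fun f => oracleOfTable (f ∘ κ)) f), prF_const, prF_const,
        sub_self, abs_zero]
      exact prF_nonneg _ _
    | inl q =>
      -- the queries of the first game from here: `q`, then the rest
      have hQ : ∀ f : List.Vector Bool a → List.Vector Bool a,
          M.queriesAux (oracleOfTable f) z (k + 1) ans =
            q :: M.queriesAux (oracleOfTable f) z k (ans ++ [oracleOfTable f q]) := fun f => by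
        conv_lhs => unfold OracleAlg.queriesAux
        simp only [hs]
      by_cases hq : q.length = a
      · set v : List.Vector Bool a := ⟨q, hq⟩ with hvdef
        have hqv : q = v.toList := rfl
        cases hτv : τ v with
        | some y =>
          -- REPEATED in the first game; by the coupling the second game answers `y` as well
          have hρv : ρ (κ v) = some y := hI.1 v y hτv
          have hev₁ : ∀ f : List.Vector Bool a → List.Vector Bool a, τ.Extends f →
              (M.runAux (oracleOfTable f) z (k + 1) ans ∈ E ↔
                M.runAux (oracleOfTable f) z k (ans ++ [y.toList]) ∈ E) := fun f hf => by
            simp only [OracleAlg.runAux_succ, hs, oracleOfTable_apply_of_length_eq f hq]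
            rw [← hvdef, hf v y hτv]
          have hev₂ : ∀ f : List.Vector Bool a → List.Vector Bool a, ρ.Extends f →
              (M.runAux (oracleOfTable (f ∘ κ)) z (k + 1) ans ∈ E ↔
                M.runAux (oracleOfTable (f ∘ κ)) z k (ans ++ [y.toList]) ∈ E) := fun f hf => by
            simp only [OracleAlg.runAux_succ, hs, oracleOfTable_apply_of_length_eq _ hq]
            rw [← hvdef, Function.comp_apply, hf (κ v) y hρv]
          -- the collision event is the same before and after the repeated query
          have hbad : ∀ f : List.Vector Bool a → List.Vector Bool a, τ.Extends f →
              (KBad M z κ (k + 1) ans τ f ↔ KBad M z κ k (ans ++ [y.toList]) τ f) := by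
            intro f hf
            have hans : oracleOfTable f q = y.toList := by
              rw [oracleOfTable_apply_of_length_eq f hq, ← hvdef, hf v y hτv]
            rw [KBad, KBad, hQ f, hans]
            constructor
            · rintro ⟨u, w, hu, hw, hne, hk⟩
              rcases List.mem_cons.1 hu with hu | hu
              · -- `u = v` is in the table: a collision with `w`
                have huv : u = v := List.Vector.eq _ _ (hu.trans hqv)
                rw [huv] at hne hk
                rcases hw with hw | hw
                · rcases List.mem_cons.1 hw with hw | hw
                  · exact absurd (List.Vector.eq _ _ (hw.trans hqv)) hne
                  · exact ⟨w, v, hw, Or.inr (by rw [hτv]; simp), hne.symm, hk.symm⟩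
                · -- both in the table: impossible by injectivity
                  obtain ⟨y', hy'⟩ := Option.ne_none_iff_exists'.1 hw
                  exact absurd (hI.2.2 w v y' y hy' hτv hk) hne
              · rcases hw with hw | hw
                · rcases List.mem_cons.1 hw with hw | hw
                  · have hwv : w = v := List.Vector.eq _ _ (hw.trans hqv)
                    exact ⟨u, w, hu, Or.inr (by rw [hwv, hτv]; simp), hne, hk⟩
                  · exact ⟨u, w, hu, Or.inl hw, hne, hk⟩
                · exact ⟨u, w, hu, Or.inr hw, hne, hk⟩
            · rintro ⟨u, w, hu, hw, hne, hk⟩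
              refine ⟨u, w, List.mem_cons_of_mem _ hu, ?_, hne, hk⟩
              rcases hw with hw | hw
              · exact Or.inl (List.mem_cons_of_mem _ hw)
              · exact Or.inr hw
          rw [prF_congr hev₁, prF_congr hev₂, prF_congr hbad]
          exact ih _ τ ρ hI
        | none =>
          cases hρv : ρ (κ v) with
          | some y' =>
            -- a COLLISION: `κ v` was already asked (through some `w ≠ v` in the table)
            obtain ⟨w, hw, hwv⟩ := hI.2.1 (κ v) y' hρv
            have hne : w ≠ v := fun h => by rw [h, hτv] at hw; exact Option.some_ne_none _ hw.symm
            have hbad : ∀ f : List.Vector Bool a → List.Vector Bool a, τ.Extends f →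
                (KBad M z κ (k + 1) ans τ f ↔ True) := fun f _ =>
              ⟨fun _ => trivial, fun _ => ⟨v, w, by rw [hQ f]; exact List.mem_cons_self,
                Or.inr (by rw [hw]; simp), hne, hwv⟩⟩
            rw [prF_congr hbad, prF_true]
            exact abs_sub_le_one_of_mem (prF_nonneg _ _) (prF_le_one _ _) (prF_nonneg _ _)
              (prF_le_one _ _)
          | none =>
            -- FRESH in both games: lazy sampling on both sides
            have hev₁ : ∀ (y : List.Vector Bool a) (f : List.Vector Bool a → List.Vector Bool a),
                PTable.Extends (Function.update τ v (some y)) f →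
                (M.runAux (oracleOfTable f) z (k + 1) ans ∈ E ↔
                  M.runAux (oracleOfTable f) z k (ans ++ [y.toList]) ∈ E) := fun y f hf => by
              have hfv : f v = y := ((PTable.extends_update_iff hτv y f).1 hf).2
              simp only [OracleAlg.runAux_succ, hs, oracleOfTable_apply_of_length_eq f hq]
              rw [← hvdef, hfv]
            have hev₂ : ∀ (y : List.Vector Bool a) (f : List.Vector Bool a → List.Vector Bool a),
                PTable.Extends (Function.update ρ (κ v) (some y)) f →
                (M.runAux (oracleOfTable (f ∘ κ)) z (k + 1) ans ∈ E ↔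
                  M.runAux (oracleOfTable (f ∘ κ)) z k (ans ++ [y.toList]) ∈ E) := fun y f hf => by
              have hfv : f (κ v) = y := ((PTable.extends_update_iff hρv y f).1 hf).2
              simp only [OracleAlg.runAux_succ, hs, oracleOfTable_apply_of_length_eq _ hq]
              rw [← hvdef, Function.comp_apply, hfv]
            have hbad : ∀ (y : List.Vector Bool a) (f : List.Vector Bool a → List.Vector Bool a),
                PTable.Extends (Function.update τ v (some y)) f →
                (KBad M z κ (k + 1) ans τ f ↔
                  KBad M z κ k (ans ++ [y.toList]) (Function.update τ v (some y)) f) := by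
              intro y f hf
              have hfv : f v = y := ((PTable.extends_update_iff hτv y f).1 hf).2
              have hans : oracleOfTable f q = y.toList := by
                rw [oracleOfTable_apply_of_length_eq f hq, ← hvdef, hfv]
              rw [KBad, KBad, hQ f, hans]
              constructor
              · rintro ⟨u, w, hu, hw, hne, hk⟩
                rcases List.mem_cons.1 hu with hu | hu
                · have huv : u = v := List.Vector.eq _ _ (hu.trans hqv)
                  rw [huv] at hne hk
                  rcases hw with hw | hw
                  · rcases List.mem_cons.1 hw with hw | hw
                    · exact absurd (List.Vector.eq _ _ (hw.trans hqv)) hne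
                    · exact ⟨w, v, hw, Or.inr (by rw [Function.update_self]; simp), hne.symm,
                        hk.symm⟩
                  · -- `w` in the old table with `κ w = κ v`: then `ρ (κ v) ≠ none`
                    obtain ⟨y', hy'⟩ := Option.ne_none_iff_exists'.1 hw
                    have := hI.1 w y' hy'
                    rw [hk, hρv] at this
                    exact absurd this (by simp)
                · refine ⟨u, w, hu, ?_, hne, hk⟩
                  rcases hw with hw | hw
                  · rcases List.mem_cons.1 hw with hw | hw
                    · have hwv : w = v := List.Vector.eq _ _ (hw.trans hqv)
                      exact Or.inr (by rw [hwv, Function.update_self]; simp)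
                    · exact Or.inl hw
                  · by_cases hwv : w = v
                    · exact Or.inr (by rw [hwv, Function.update_self]; simp)
                    · exact Or.inr (by rw [Function.update_of_ne hwv]; exact hw)
              · rintro ⟨u, w, hu, hw, hne, hk⟩
                refine ⟨u, w, List.mem_cons_of_mem _ hu, ?_, hne, hk⟩
                rcases hw with hw | hw
                · exact Or.inl (List.mem_cons_of_mem _ hw)
                · by_cases hwv : w = v
                  · exact Or.inl (by rw [hwv, ← hqv]; exact List.mem_cons_self)
                  · exact Or.inr (by rw [Function.update_of_ne hwv] at hw; exact hw)
            rw [prF_fresh hτv hev₁, prF_fresh hρv hev₂, prF_fresh hτv hbad, ← sub_div,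
              ← Finset.sum_sub_distrib, abs_div, abs_of_pos (by positivity : (0 : ℝ) < 2 ^ a)]
            refine div_le_div_of_nonneg_right ?_ (by positivity)
            refine (Finset.abs_sum_le_sum_abs _ _).trans (Finset.sum_le_sum fun y _ => ?_)
            exact ih (ans ++ [y.toList]) _ _ (hI.update hτv hρv y)
      · -- ill-formed query: answered `[]` in both games
        have hev₁ : ∀ f : List.Vector Bool a → List.Vector Bool a,
            (M.runAux (oracleOfTable f) z (k + 1) ans ∈ E ↔
              M.runAux (oracleOfTable f) z k (ans ++ [[]]) ∈ E) := fun f => by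
          simp only [OracleAlg.runAux_succ, hs, oracleOfTable_apply_of_length_ne f hq]
        have hev₂ : ∀ f : List.Vector Bool a → List.Vector Bool a,
            (M.runAux (oracleOfTable (f ∘ κ)) z (k + 1) ans ∈ E ↔
              M.runAux (oracleOfTable (f ∘ κ)) z k (ans ++ [[]]) ∈ E) := fun f => by
          simp only [OracleAlg.runAux_succ, hs, oracleOfTable_apply_of_length_ne _ hq]
        have hbad : ∀ f : List.Vector Bool a → List.Vector Bool a,
            (KBad M z κ (k + 1) ans τ f ↔ KBad M z κ k (ans ++ [[]]) τ f) := by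
          intro f
          have hans : oracleOfTable f q = [] := oracleOfTable_apply_of_length_ne f hq
          have hnot : ∀ u : List.Vector Bool a, u.toList ≠ q := fun u h =>
            hq (by rw [← h, u.toList_length])
          rw [KBad, KBad, hQ f, hans]
          constructor
          · rintro ⟨u, w, hu, hw, hne, hk⟩
            refine ⟨u, w, (List.mem_cons.1 hu).resolve_left (hnot u), ?_, hne, hk⟩
            rcases hw with hw | hw
            · exact Or.inl ((List.mem_cons.1 hw).resolve_left (hnot w))
            · exact Or.inr hw
          · rintro ⟨u, w, hu, hw, hne, hk⟩
            refine ⟨u, w, List.mem_cons_of_mem _ hu, ?_, hne, hk⟩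
            rcases hw with hw | hw
            · exact Or.inl (List.mem_cons_of_mem _ hw)
            · exact Or.inr hw
        rw [prF_congr (fun f _ => hev₁ f), prF_congr (fun f _ => hev₂ f),
          prF_congr (fun f _ => hbad f)]
        exact ih _ τ ρ hI

/-- **Identical until a `κ`-collision, unconditioned**: from empty tables, the games "uniformly
random `h`" and "uniformly random `h`, queried through `κ`" differ on every event by at most the
probability that the first run asks two distinct well-formed queries with the same `κ`-image.
[cite: ServedioGortler2004, Thm. 6.1 (ii)] -/
theorem abs_prF_sub_prF_kappa_le_root (M : OracleAlg β) (z : List Bool) (E : Set (Option β))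
    (κ : List.Vector Bool a → List.Vector Bool a) (k : ℕ) :
    |prF (fun _ => none) (fun h : List.Vector Bool a → List.Vector Bool a =>
          M.runAux (oracleOfTable h) z k [] ∈ E) -
        prF (fun _ => none) (fun h : List.Vector Bool a → List.Vector Bool a =>
          M.runAux (oracleOfTable (h ∘ κ)) z k [] ∈ E)| ≤
      prF (fun _ => none) (KBad M z κ k [] fun _ => none) :=
  abs_prF_sub_prF_kappa_le M z E κ k [] _ _ (kInv_bot κ)

/-! ### Counting the bad masks -/

/-- The well-formed queries of a run, as a finite set of points of `{0,1}^a` (at most `k` of them).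
[folklore] -/
noncomputable def queryPts (M : OracleAlg β) (z : List Bool) (k : ℕ)
    (h : List.Vector Bool a → List.Vector Bool a) : Finset (List.Vector Bool a) :=
  open scoped Classical in
  Finset.univ.filter fun u => u.toList ∈ M.queriesAux (oracleOfTable h) z k []

/-- A run with fuel `k` asks at most `k` well-formed queries. [folklore] -/
theorem card_queryPts_le (M : OracleAlg β) (z : List Bool) (k : ℕ)
    (h : List.Vector Bool a → List.Vector Bool a) : (queryPts M z k h).card ≤ k := by
  classical
  have hinj : Set.InjOn (fun u : List.Vector Bool a => u.toList) ↑(queryPts M z k h) :=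
    fun u _ w _ huw => List.Vector.eq _ _ huw
  calc (queryPts M z k h).card
      = ((queryPts M z k h).image fun u => u.toList).card := (Finset.card_image_of_injOn hinj).symm
    _ ≤ (M.queriesAux (oracleOfTable h) z k []).toFinset.card := by
        refine Finset.card_le_card fun q hq => ?_
        obtain ⟨u, hu, rfl⟩ := Finset.mem_image.1 hq
        exact List.mem_toFinset.2 (Finset.mem_filter.1 hu).2
    _ ≤ (M.queriesAux (oracleOfTable h) z k []).length := List.toFinset_card_le _
    _ ≤ k := M.length_queriesAux_le _ z k []

/-- **For a fixed run, at most `k²` masks collide**: a collision `repV s u = repV s w`, `u ≠ w`,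
among the (at most `k`) well-formed queries forces `s = w ⊕ u`.
[cite: ServedioGortler2004, Thm. 6.1 (ii)] -/
theorem card_badMasks_le (M : OracleAlg β) (z : List Bool) (k : ℕ)
    (h : List.Vector Bool a → List.Vector Bool a) :
    open scoped Classical in
    (Finset.univ.filter fun s : List.Vector Bool a => KBad M z (repV s) k [] (fun _ => none) h).card ≤
      k ^ 2 := by
  classical
  set Q := queryPts M z k h with hQ
  have hsub : (Finset.univ.filter fun s : List.Vector Bool a => KBad M z (repV s) k [] (fun _ => none) h) ⊆
      (Q ×ˢ Q).image fun p => xorV p.1 p.2 := by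
    intro s hs
    obtain ⟨u, w, hu, hw, hne, hk⟩ := (Finset.mem_filter.1 hs).2
    rcases hw with hw | hw
    · refine Finset.mem_image.2 ⟨(u, w), Finset.mem_product.2 ⟨?_, ?_⟩, ?_⟩
      · exact Finset.mem_filter.2 ⟨Finset.mem_univ _, hu⟩
      · exact Finset.mem_filter.2 ⟨Finset.mem_univ _, hw⟩
      · exact (eq_xorV_of_repV_eq hk hne).symm
    · exact absurd rfl hw
  calc _ ≤ ((Q ×ˢ Q).image fun p => xorV p.1 p.2).card := Finset.card_le_card hsub
    _ ≤ (Q ×ˢ Q).card := Finset.card_image_le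
    _ = Q.card * Q.card := Finset.card_product _ _
    _ ≤ k * k := Nat.mul_le_mul (card_queryPts_le M z k h) (card_queryPts_le M z k h)
    _ = k ^ 2 := (sq k).symm

/-- **Over all masks, the collision probabilities sum to at most `k²`** (swap the sum over masks
with the average over tables). [cite: ServedioGortler2004, Thm. 6.1 (ii)] -/
theorem sum_prF_maskBad_le (M : OracleAlg β) (z : List Bool) (k : ℕ) :
    ∑ s : List.Vector Bool a, prF (fun _ => none) (KBad M z (repV s) k [] fun _ => none) ≤
      (k : ℝ) ^ 2 := by
  classical
  -- double counting in `ℕ`: `∑_s #{h : bad} = ∑_h #{s : bad} ≤ #tables · k²`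
  have hnat : ∑ s : List.Vector Bool a,
      (Finset.univ.filter fun h : List.Vector Bool a → List.Vector Bool a =>
          KBad M z (repV s) k [] (fun _ => none) h).card ≤
        Fintype.card (List.Vector Bool a → List.Vector Bool a) * k ^ 2 := by
    simp only [Finset.card_filter]
    rw [Finset.sum_comm]
    calc ∑ h : List.Vector Bool a → List.Vector Bool a, ∑ s : List.Vector Bool a,
          (if KBad M z (repV s) k [] (fun _ => none) h then 1 else 0)
        ≤ ∑ _h : List.Vector Bool a → List.Vector Bool a, k ^ 2 := by
          refine Finset.sum_le_sum fun h _ => ?_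
          rw [← Finset.card_filter]
          exact card_badMasks_le M z k h
      _ = Fintype.card (List.Vector Bool a → List.Vector Bool a) * k ^ 2 := by
          rw [Finset.sum_const, Finset.card_univ, smul_eq_mul]
  have hC : (0 : ℝ) < Fintype.card (List.Vector Bool a → List.Vector Bool a) := by
    exact_mod_cast Fintype.card_pos
  have hterm : ∀ s : List.Vector Bool a,
      prF (fun _ => none) (KBad M z (repV s) k [] fun _ => none) =
        ((Finset.univ.filter fun h : List.Vector Bool a → List.Vector Bool a =>
            KBad M z (repV s) k [] (fun _ => none) h).card : ℝ) /
          Fintype.card (List.Vector Bool a → List.Vector Bool a) := fun s => prF_bot_eq _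
  simp only [hterm]
  rw [← Finset.sum_div, div_le_iff₀ hC]
  have h' : ((∑ s : List.Vector Bool a,
      (Finset.univ.filter fun h : List.Vector Bool a → List.Vector Bool a =>
          KBad M z (repV s) k [] (fun _ => none) h).card : ℕ) : ℝ) ≤
        ((Fintype.card (List.Vector Bool a → List.Vector Bool a) * k ^ 2 : ℕ) : ℝ) := by
    exact_mod_cast hnat
  push_cast at h'
  linarith

/-- **The XOR-mask lemma** (classical half of Simon's analysis). For a deterministic transcript
algorithm with fuel `k`, a uniformly random function `h : {0,1}^a → {0,1}^a` and any nonempty set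
`S` of masks: on average over `s ∈ S`, the games "oracle `h`" and "oracle `h ∘ rep_s`" differ on
every event by at most `k²/|S|`. [cite: ServedioGortler2004, Thm. 6.1 (ii)] [cite: AaronsonChen2017, §1 (p. 9)] -/
theorem avg_abs_prF_sub_prF_rep_le (M : OracleAlg β) (z : List Bool) (E : Set (Option β)) (k : ℕ)
    (S : Finset (List.Vector Bool a)) (hS : S.Nonempty) :
    (∑ s ∈ S, |prF (fun _ => none) (fun h : List.Vector Bool a → List.Vector Bool a =>
          M.runAux (oracleOfTable h) z k [] ∈ E) -
        prF (fun _ => none) (fun h : List.Vector Bool a → List.Vector Bool a =>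
          M.runAux (oracleOfTable (h ∘ repV s)) z k [] ∈ E)|) / S.card ≤
      (k : ℝ) ^ 2 / S.card := by
  have hcard : (0 : ℝ) < S.card := by exact_mod_cast hS.card_pos
  refine div_le_div_of_nonneg_right ?_ hcard.le
  calc _ ≤ ∑ s ∈ S, prF (fun _ => none) (KBad M z (repV s) k [] fun _ => none) :=
        Finset.sum_le_sum fun s _ => abs_prF_sub_prF_kappa_le_root M z E (repV s) k
    _ ≤ ∑ s : List.Vector Bool a, prF (fun _ => none) (KBad M z (repV s) k [] fun _ => none) :=
        Finset.sum_le_sum_of_subset_of_nonneg (Finset.subset_univ S) fun s _ _ => prF_nonneg _ _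
    _ ≤ (k : ℝ) ^ 2 := sum_prF_maskBad_le M z k

/-- **The switching lemma under a mask**: against a uniformly random function versus a uniformly
random permutation, both queried through `rep_s`, a fuel-`k` transcript algorithm's output
distribution changes by at most `k²/2^a` on every event (the switching lemma of
`PRPSwitchingLemma.lean` applied to the query-translated algorithm `M.mapQuery (repStr s)`).
[cite: Goldreich2001, Prop. 3.7.3 (p. 201)] -/
theorem abs_prF_sub_prP_rep_le_root (M : OracleAlg β) (z : List Bool) (E : Set (Option β)) (k : ℕ)
    (s : List.Vector Bool a) :
    |prF (fun _ => none) (fun h : List.Vector Bool a → List.Vector Bool a =>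
          M.runAux (oracleOfTable (h ∘ repV s)) z k [] ∈ E) -
        prP (fun _ => none) (fun h : List.Vector Bool a → List.Vector Bool a =>
          M.runAux (oracleOfTable (h ∘ repV s)) z k [] ∈ E)| ≤
      (k : ℝ) ^ 2 / 2 ^ a := by
  have key : ∀ h : List.Vector Bool a → List.Vector Bool a,
      M.runAux (oracleOfTable (h ∘ repV s)) z k [] =
        (M.mapQuery (qOnly (repStr s.toList))).runAux (oracleOfTable h) z k [] := fun h => by
    rw [oracleOfTable_comp_repV]
    exact (run_mapQuery_qOnly M (repStr s.toList) (oracleOfTable h) k z).symm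
  simp_rw [key]
  exact abs_prF_sub_prP_le_root _ z E k

end Kappa

end Literature.Computability.Cryptography
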